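import Summits.Ventures.HodgeRepro2.T5BergmanIntegrableSharp
import Summits.Ventures.HodgeRepro2.T5BergmanIntegrableKFinite

/-!
# The `L^p` threshold of the matrix coefficients of `π_k`: `⟨π_k(g) 1, 1⟩_k ∈ L^p(SU(1,1))` iff `k p > 2`

`T5BergmanIntegrableSharp` decides when `|a(g)|^{-s}` is integrable on `SU(1,1)` (`s > 2`). Since
`|⟨π_k(g) 1, 1⟩_k|^p = (π/(k-1))^p |a(g)|^{-kp}`, this is the `L^p` threshold of the lowest-weight
matrix coefficient of the weight-`k` Bergman model:

  `g ↦ ⟨π_k(g) 1, 1⟩_k ∈ L^p(SU(1,1), μ)`  ⟺  `k p > 2`   (`memLp_matrixCoeff_lowest_lowest_iff`),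

for every Haar measure `μ` and every real `p > 0` — `p = 2` recovers the square-integrability of every
`k ≥ 2` (`T5BergmanSchur`), `p = 1` the integrability threshold `k ≥ 3`; and `π₂⁺` lies in `L^p` exactly
for `p > 1`. With the decay bound `|⟨π_k(g) f, h⟩_k| ≤ C |a(g)|^{-k}` for `K`-finite `f, h`
(`T5BergmanKTypeMatrix`, `T5BergmanIntegrableKFinite`) the upper half holds for EVERY `K`-finite matrix
coefficient: `⟨π_k(g) S_N, T_M⟩_k ∈ L^p(SU(1,1), μ)` whenever `k p > 2`
(`memLp_matrixCoeff_partialSum_partialSum`) — the classical `L^{2/k + ε}` statement for the holomorphic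
discrete series of `SU(1,1)`. Nothing is claimed about (N).

Blind lane: Mathlib + the HodgeRepro2 prefix only; no sorry; axioms ⊆ {propext, Classical.choice,
Quot.sound}.
-/

namespace Summit.Ventures.HodgeRepro2.T5BergmanCoefficientLp

open MeasureTheory MeasureTheory.Measure Metric Filter Topology Set Finset
open T5PoincareDensity T5PoincareMeasure T5SU11Unimodular T5SU11Fibration T5SU11FibrationHaar
  T5SU11FibrationCartan T5HaarCircle
open T5BergmanCoefficient T5BergmanPairing T5BergmanFourier T5BergmanParseval T5BergmanActStable
  T5BergmanMatrixCoeff T5BergmanSchur T5BergmanKTypeMatrix T5BergmanIntegrableCoeff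
  T5BergmanDiscThreshold T5BergmanIntegrableSharp T5BergmanIntegrableKFinite
open scoped Real ENNReal NNReal

/-! ### `L^p` membership as the integrability of `‖f‖^p` -/

/-- For `p > 0` and an a.e.-strongly measurable `f`: `f ∈ L^p(μ)` iff `‖f‖^p ∈ L¹(μ)` (Mathlib's
`memLp_norm_rpow_iff` at the exponent `p / p = 1`). -/
lemma memLp_ofReal_iff_integrable_norm_rpow {α E : Type*} [MeasurableSpace α] {μ : Measure α}
    [NormedAddCommGroup E] {f : α → E} (hf : AEStronglyMeasurable f μ) {p : ℝ} (hp : 0 < p) :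
    MemLp f (ENNReal.ofReal p) μ ↔ Integrable (fun x => ‖f x‖ ^ p) μ := by
  have hq0 : ENNReal.ofReal p ≠ 0 := (ENNReal.ofReal_pos.mpr hp).ne'
  have hqt : ENNReal.ofReal p ≠ ∞ := ENNReal.ofReal_ne_top
  rw [← memLp_norm_rpow_iff hf hq0 hqt, ENNReal.div_self hq0 hqt, memLp_one_iff_integrable,
    ENNReal.toReal_ofReal hp.le]

/-- `|x^s|^p = x^{s p}` for `x ≥ 0`. -/
lemma norm_rpow_rpow_of_nonneg {x : ℝ} (hx : 0 ≤ x) (s p : ℝ) : ‖x ^ s‖ ^ p = x ^ (s * p) := by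
  rw [Real.norm_eq_abs, abs_of_nonneg (Real.rpow_nonneg hx _), ← Real.rpow_mul hx]

variable [MeasurableSpace Circle] [BorelSpace Circle]

/-- **The `L^p` threshold of `|a(g)|^{-s}`**: `|a(g)|^{-s} ∈ L^p(SU(1,1), μ)` iff `s p > 2`, for real `s`
and real `p > 0`. -/
theorem memLp_norm_mat_inv_rpow_iff (μ : Measure SU11) [IsHaarMeasure μ] (s : ℝ) {p : ℝ}
    (hp : 0 < p) :
    MemLp (fun g => ‖mat g 0 0‖⁻¹ ^ s) (ENNReal.ofReal p) μ ↔ 2 < s * p := by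
  rw [memLp_ofReal_iff_integrable_norm_rpow (continuous_norm_mat_inv_rpow s).aestronglyMeasurable hp]
  have e : (fun g : SU11 => ‖‖mat g 0 0‖⁻¹ ^ s‖ ^ p) = fun g => ‖mat g 0 0‖⁻¹ ^ (s * p) := by
    ext g
    exact norm_rpow_rpow_of_nonneg (by positivity) s p
  rw [e, integrable_norm_mat_inv_rpow_iff]

/-- The natural-exponent form: `|a(g)|^{-k} ∈ L^p(SU(1,1), μ)` iff `k p > 2`. -/
theorem memLp_norm_mat_inv_pow_iff (μ : Measure SU11) [IsHaarMeasure μ] (k : ℕ) {p : ℝ}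
    (hp : 0 < p) :
    MemLp (fun g => ‖mat g 0 0‖⁻¹ ^ k) (ENNReal.ofReal p) μ ↔ 2 < (k : ℝ) * p := by
  have e : (fun g : SU11 => ‖mat g 0 0‖⁻¹ ^ k) = fun g => ‖mat g 0 0‖⁻¹ ^ (k : ℝ) := by
    ext g
    rw [Real.rpow_natCast]
  rw [e, memLp_norm_mat_inv_rpow_iff μ _ hp]

/-! ### The lowest-weight coefficient: the threshold is sharp -/

/-- **THE `L^p` THRESHOLD of the lowest-weight matrix coefficient**: for `k ≥ 2`, every Haar measure `μ`
of `SU(1,1)` and every real `p > 0`, `g ↦ ⟨π_k(g) 1, 1⟩_k ∈ L^p(μ)` iff `k p > 2`. -/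
theorem memLp_matrixCoeff_lowest_lowest_iff (μ : Measure SU11) [IsHaarMeasure μ] (k : ℕ)
    (hk : 2 ≤ k) {p : ℝ} (hp : 0 < p) :
    MemLp (matrixCoeff k lowest lowest) (ENNReal.ofReal p) μ ↔ 2 < (k : ℝ) * p := by
  have hk1 : (1 : ℝ) < k := by exact_mod_cast (by omega : 1 < k)
  have hc : (0 : ℝ) < π / ((k : ℝ) - 1) := div_pos Real.pi_pos (by linarith)
  have hint : IntegrableOn (fun w => ‖lowest w‖ ^ 2 * (1 - ‖w‖ ^ 2) ^ (k - 2)) (ball (0 : ℂ) 1) := by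
    refine (integrableOn_monomial k 0).congr_fun (fun w _ => ?_) measurableSet_ball
    simp [lowest]
  have hcont : Continuous (matrixCoeff k lowest lowest) :=
    continuous_matrixCoeff_of_differentiableOn k hk lowest (differentiableOn_const 1) hint lowest
      (differentiableOn_const 1) hint
  rw [memLp_ofReal_iff_integrable_norm_rpow hcont.aestronglyMeasurable hp]
  have e : (fun g => ‖matrixCoeff k lowest lowest g‖ ^ p) =
      fun g => (π / ((k : ℝ) - 1)) ^ p * ‖mat g 0 0‖⁻¹ ^ ((k : ℝ) * p) := by
    ext g
    rw [norm_matrixCoeff_lowest_lowest k hk g, Real.mul_rpow hc.le (by positivity),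
      ← Real.rpow_natCast _ k, ← Real.rpow_mul (by positivity)]
  rw [e, integrable_const_mul_iff (isUnit_iff_ne_zero.mpr (Real.rpow_pos_of_pos hc p).ne'),
    integrable_norm_mat_inv_rpow_iff]

/-- `π₂⁺` lies in `L^p` exactly for `p > 1` (read on its lowest-weight coefficient). -/
theorem memLp_matrixCoeff_lowest_lowest_two_iff (μ : Measure SU11) [IsHaarMeasure μ] {p : ℝ}
    (hp : 0 < p) :
    MemLp (matrixCoeff 2 lowest lowest) (ENNReal.ofReal p) μ ↔ 1 < p := by
  rw [memLp_matrixCoeff_lowest_lowest_iff μ 2 le_rfl hp]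
  push_cast
  constructor <;> intro h <;> linarith

/-- Square-integrability of the lowest-weight coefficient for every `k ≥ 2` (`p = 2`: `2k > 2`), as a
consequence of the threshold (the Schur relation of `T5BergmanSchur` gives the value of the integral). -/
theorem memLp_two_matrixCoeff_lowest_lowest (μ : Measure SU11) [IsHaarMeasure μ] (k : ℕ)
    (hk : 2 ≤ k) : MemLp (matrixCoeff k lowest lowest) 2 μ := by
  have h := (memLp_matrixCoeff_lowest_lowest_iff μ k hk (p := 2) (by norm_num)).mpr (by
    have : (2 : ℝ) ≤ k := by exact_mod_cast hk
    linarith)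
  rwa [show ENNReal.ofReal (2 : ℝ) = 2 by norm_num] at h

/-! ### Every `K`-finite matrix coefficient lies in `L^p` for `k p > 2` -/

/-- **The monomial coefficients**: `g ↦ ⟨π_k(g) zᵐ, zⁿ⟩_k ∈ L^p(SU(1,1), μ)` whenever `k p > 2`
(`k ≥ 2`, `p > 0`), from the decay bound `|⟨π_k(g) zᵐ, zⁿ⟩_k| ≤ C_{m,n} ⟨zⁿ,zⁿ⟩_k |a(g)|^{-k}`. -/
theorem memLp_matrixCoeff_monomial_monomial (μ : Measure SU11) [IsHaarMeasure μ] (k : ℕ) (hk : 2 ≤ k)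
    (m n : ℕ) {p : ℝ} (hp : 0 < p) (hkp : 2 < (k : ℝ) * p) :
    MemLp (matrixCoeff k (fun z => z ^ m) (fun z => z ^ n)) (ENNReal.ofReal p) μ := by
  have hcont : Continuous (matrixCoeff k (fun z => z ^ m) (fun z => z ^ n)) :=
    continuous_matrixCoeff_of_differentiableOn k hk _ (differentiableOn_monomial m)
      (integrableOn_monomial k m) _ (differentiableOn_monomial n) (integrableOn_monomial k n)
  rw [memLp_ofReal_iff_integrable_norm_rpow hcont.aestronglyMeasurable hp]
  have hC : 0 ≤ decayConst k m n * monomialNormSq k n := by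
    refine mul_nonneg ?_ (monomialNormSq_pos k n).le
    unfold decayConst
    exact Finset.sum_nonneg fun i _ => by positivity
  refine ((integrable_norm_mat_inv_rpow μ hkp).const_mul
    ((decayConst k m n * monomialNormSq k n) ^ p)).mono' (hcont.norm.rpow_const fun g =>
      Or.inr hp.le).aestronglyMeasurable (Eventually.of_forall fun g => ?_)
  have h1 := norm_matrixCoeff_monomial_monomial_le k hk g m n
  rw [Real.norm_eq_abs, abs_of_nonneg (Real.rpow_nonneg (norm_nonneg _) _)]
  calc ‖matrixCoeff k (fun z => z ^ m) (fun z => z ^ n) g‖ ^ p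
      ≤ (decayConst k m n * monomialNormSq k n * ‖mat g 0 0‖⁻¹ ^ k) ^ p :=
        Real.rpow_le_rpow (norm_nonneg _) h1 hp.le
    _ = (decayConst k m n * monomialNormSq k n) ^ p * ‖mat g 0 0‖⁻¹ ^ ((k : ℝ) * p) := by
        rw [Real.mul_rpow hC (by positivity), ← Real.rpow_natCast _ k,
          ← Real.rpow_mul (by positivity)]

/-- **Every `K`-finite matrix coefficient lies in `L^p` for `k p > 2`**: for polynomials `S_N, T_M`,
`g ↦ ⟨π_k(g) S_N, T_M⟩_k ∈ L^p(SU(1,1), μ)` whenever `k p > 2` (`k ≥ 2`, `p > 0`) — the holomorphic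
discrete series of weight `k` is «`L^{2/k+ε}`». -/
theorem memLp_matrixCoeff_partialSum_partialSum (μ : Measure SU11) [IsHaarMeasure μ] (k : ℕ)
    (hk : 2 ≤ k) (a b : ℕ → ℂ) (N M : ℕ) {p : ℝ} (hp : 0 < p) (hkp : 2 < (k : ℝ) * p) :
    MemLp (matrixCoeff k (partialSum a N) (partialSum b M)) (ENNReal.ofReal p) μ := by
  have e : matrixCoeff k (partialSum a N) (partialSum b M) = fun g => ∑ m ∈ range N, ∑ n ∈ range M,
      a m * (starRingEnd ℂ) (b n) * matrixCoeff k (fun w => w ^ m) (fun w => w ^ n) g :=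
    funext fun g => matrixCoeff_partialSum_partialSum k hk a b N M g
  rw [e]
  refine memLp_finsetSum _ fun m _ => memLp_finsetSum _ fun n _ => ?_
  exact (memLp_matrixCoeff_monomial_monomial μ k hk m n hp hkp).const_mul _

end Summit.Ventures.HodgeRepro2.T5BergmanCoefficientLp
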